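import Summits.Ventures.LatticeQCDFlow.Scaling.ParallelTemperingHalfSweep

/-!
HONEST FRAMING: exact (Metropolis-corrected) sampling algorithms for lattice gauge theory; figures
of merit are autocorrelation/cost numbers at stated couplings and volumes; no continuum-physics
claim.

# ParallelTemperingFullSweep — THE DETERMINISTIC EVEN–ODD SWEEP OF ALL `K` SWAP ATTEMPTS AS ONE STEP: THE TAG
# MOVES BY AT MOST TWO LEVELS, WITH PROBABILITY OF STATIONARY MEAN AT MOST `ā_K`, HENCE
# `ρ_τ(1) ≥ 1 − 24ā_K/(K(K+2)) ≥ 1 − 192/(e·m·(b−a)²)` PER SWEEP, FOR EVERY NUMBER OF REPLICAS (lean-2 GEN-15, ours)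

Venture-side (OURS).  Cell `lqcd-flow` (pub-lqcd), unit `pub-lqcd-lean-2-g15`, 2026-08-24.  Fourth file of the
half-sweep chapter.  `Scaling/ParallelTemperingHalfSweep` treats the even and odd half-sweeps `E`, `O` and the
random-parity half-sweep (nearest-neighbour tag moves ⇒ an exact law).  The schedule used in practice is the
DETERMINISTIC alternation `F = O ∘ₖ E` — all `K` pairs once per step.  Under `F` the tag can move two levels, so
GEN-14's identity does not apply; GEN-13's general movement bound (`Scaling/LevelAutocorrelationFloor.
sq_integral_sub_autocov_le`, moves of size `≤ ℓ` with probability `≤ r`: `∫f² − autocov₁ ≤ (ℓ²/2)∫r dπ`) does, with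
`ℓ = 2` and `r = m_E + E(m_O)` (`m_E`, `m_O` the exact half-sweep move probabilities), whose stationary mean is
`ā_K` by the invariance of the target under `E`.

## What is proved (`X` bounded measurable, `μ` a probability measure)

* §1 (general `E`, kernels `κ`, `η`, measurable level): `comp_level_moves_le_two` (two nearest-neighbour steps move
  the level by at most two); **`comp_real_moves_le`** (`(η ∘ₖ κ)(x){lev ≠ lev x} ≤ κ(x){lev ≠ lev x} +
  ∫ η(y){lev ≠ lev y} κ(x,dy)`).
* §2 **`ptFullSweep hXm β K = O ∘ₖ E`**: Markov, `invariant_ptFullSweep`, `ptFullSweep_moves_le_two`,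
  `ptFullSweep_real_moves_le` (`≤ m_E + kop E m_O`), `ptFullSweep_rate_integral` (`∫ (m_E + kop E m_O) dπ = ā_K`);
  **`ptFullScan_level_lagOneAutocorr_ge`** — for `Mk ∘ₖ F` with ANY tag-preserving Markov replica update `Mk`
  (`K ≥ 1`): `ρ_τ(1) ≥ 1 − 24ā_K/(K(K+2))`; **`ptFullScan_level_lagOneAutocorr_ge_kfree`** — on the uniform ladder
  from `a` to `b > a` with a variance floor `0 < m ≤ Var_{μ_u}(X)`: `ρ_τ(1) ≥ 1 − 192/(e·m·(b−a)²)` per sweep for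
  EVERY `K ≥ 1`.

Reading (no numerics implied): attempting every adjacent swap at every step does not escape the diffusive law — per
sweep the tagged replica's level still decorrelates at rate `O(ā_K/K²) = O(1/(m(b−a)²))`, a factor `8` above the
random-parity half-sweep's exact `3ā_K/(K(K+2))`.  NOT CLAIMED: an identity for `F` (the cross term of the two
half-moves is not a function of the adjacent acceptances); `τ_int` for `F` (not reversible); anything measured.
Literature grade (cell rule): TEXTBOOK ALGORITHM + KNOWN MECHANISM, NEW TYPING; nothing cited as a fact; no new bib
keys.
-/

noncomputable section

open MeasureTheory ProbabilityTheory Set Filter Finset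
open Summit.Ventures.LatticeQCDFlow.Exactness Summit.Ventures.LatticeQCDFlow.Scoring
open scoped ENNReal

namespace Summit.Ventures.LatticeQCDFlow.Scaling

/-! ## §1 Two steps: the level moves by at most two, with probability at most the sum -/

section TwoSteps

variable {E : Type*} [MeasurableSpace E] {κ η : Kernel E E} {lev : E → ℕ}

/-- **Two nearest-neighbour steps move the level by at most two.** [folklore] -/
theorem comp_level_moves_le_two [IsMarkovKernel η] (hlev : Measurable lev)
    (hκ : ∀ x, ∀ᵐ y ∂(κ x), |((lev y : ℕ) : ℝ) - lev x| ≤ 1)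
    (hη : ∀ x, ∀ᵐ y ∂(η x), |((lev y : ℕ) : ℝ) - lev x| ≤ 1) (x : E) :
    ∀ᵐ y ∂((η ∘ₖ κ) x), |((lev y : ℕ) : ℝ) - lev x| ≤ 2 := by
  rw [ae_iff]
  have hB : MeasurableSet {y : E | ¬ |((lev y : ℕ) : ℝ) - lev x| ≤ 2} := by
    have e : {y : E | ¬ |((lev y : ℕ) : ℝ) - lev x| ≤ 2} = lev ⁻¹' {n : ℕ | ¬ |((n : ℕ) : ℝ) - lev x| ≤ 2} := by
      ext y; simp
    rw [e]; exact hlev MeasurableSet.of_discrete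
  rw [Kernel.comp_apply' _ _ _ hB]
  refine (lintegral_eq_zero_iff (η.measurable_coe hB)).2 ?_
  filter_upwards [hκ x] with y hy
  have h0 : η y {y' : E | ¬ |((lev y' : ℕ) : ℝ) - lev y| ≤ 1} = 0 := ae_iff.1 (hη y)
  refine measure_mono_null (fun y' hy' => ?_) h0
  simp only [Set.mem_setOf_eq] at hy' ⊢
  intro h1
  apply hy'
  calc |((lev y' : ℕ) : ℝ) - lev x| = |(((lev y' : ℕ) : ℝ) - lev y) + (((lev y : ℕ) : ℝ) - lev x)| := by ring_nf
    _ ≤ |((lev y' : ℕ) : ℝ) - lev y| + |((lev y : ℕ) : ℝ) - lev x| := abs_add_le _ _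
    _ ≤ 1 + 1 := add_le_add h1 hy
    _ = 2 := by norm_num

/-- The level-move set is measurable. [folklore] -/
theorem measurableSet_levelMoved (hlev : Measurable lev) (x : E) : MeasurableSet {y : E | lev y ≠ lev x} :=
  (hlev (measurableSet_singleton (lev x))).compl

/-- **Two steps move the level with probability at most the sum**:
`(η ∘ₖ κ)(x){lev ≠ lev x} ≤ κ(x){lev ≠ lev x} + ∫ η(y){lev ≠ lev y} κ(x,dy)`. [folklore] -/
theorem comp_real_moves_le [IsMarkovKernel κ] [IsMarkovKernel η] (hlev : Measurable lev) (x : E) :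
    ((η ∘ₖ κ) x).real {y | lev y ≠ lev x} ≤
      (κ x).real {y | lev y ≠ lev x} + ∫ y, (η y).real {y' | lev y' ≠ lev y} ∂(κ x) := by
  have hS := measurableSet_levelMoved hlev x
  -- pointwise: `η y S_x ≤ 1_{S_x}(y) + η y S_y`
  have hpt : ∀ y, η y {y' | lev y' ≠ lev x} ≤
      ({y | lev y ≠ lev x} : Set E).indicator 1 y + η y {y' | lev y' ≠ lev y} := by
    intro y
    by_cases h : lev y = lev x
    · have hy : y ∉ ({y | lev y ≠ lev x} : Set E) := by simp [h]
      rw [Set.indicator_of_notMem hy, zero_add]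
      have e : {y' : E | lev y' ≠ lev x} = {y' | lev y' ≠ lev y} := by rw [h]
      rw [e]
    · have hy : y ∈ ({y | lev y ≠ lev x} : Set E) := h
      rw [Set.indicator_of_mem hy, Pi.one_apply]
      exact le_add_right prob_le_one
  have hm : Measurable fun y => η y {y' | lev y' ≠ lev y} := by
    have hf1 : Measurable fun p : E × E => lev p.1 := hlev.comp measurable_fst
    have hf2 : Measurable fun p : E × E => lev p.2 := hlev.comp measurable_snd
    have hT : MeasurableSet {p : E × E | lev p.2 ≠ lev p.1} := by
      have e : {p : E × E | lev p.2 ≠ lev p.1} = {p : E × E | lev p.2 = lev p.1}ᶜ := by ext p; simp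
      rw [e]
      exact (measurableSet_eq_fun (hf2.comp measurable_id) (hf1.comp measurable_id)).compl
    exact Kernel.measurable_kernel_prodMk_left hT
  -- integrate
  have h1 : (η ∘ₖ κ) x {y | lev y ≠ lev x} ≤ κ x {y | lev y ≠ lev x} + ∫⁻ y, η y {y' | lev y' ≠ lev y} ∂(κ x) := by
    rw [Kernel.comp_apply' _ _ _ hS]
    calc ∫⁻ y, η y {y' | lev y' ≠ lev x} ∂(κ x)
        ≤ ∫⁻ y, ({y | lev y ≠ lev x} : Set E).indicator 1 y + η y {y' | lev y' ≠ lev y} ∂(κ x) :=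
          lintegral_mono fun y => hpt y
      _ = κ x {y | lev y ≠ lev x} + ∫⁻ y, η y {y' | lev y' ≠ lev y} ∂(κ x) := by
          rw [lintegral_add_left (measurable_one.indicator hS), lintegral_indicator_one hS]
  -- convert to reals
  have hfin1 : κ x {y | lev y ≠ lev x} ≠ ∞ := measure_ne_top _ _
  have hfin2 : ∫⁻ y, η y {y' | lev y' ≠ lev y} ∂(κ x) ≠ ∞ := by
    refine ne_of_lt (lt_of_le_of_lt (lintegral_mono fun y => (prob_le_one : η y {y' | lev y' ≠ lev y} ≤ 1)) ?_)
    simp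
  have e2 : ∫ y, (η y).real {y' | lev y' ≠ lev y} ∂(κ x) = (∫⁻ y, η y {y' | lev y' ≠ lev y} ∂(κ x)).toReal := by
    simp only [measureReal_def]
    rw [integral_toReal hm.aemeasurable (ae_of_all _ fun y => measure_lt_top _ _)]
  rw [measureReal_def, measureReal_def, e2, ← ENNReal.toReal_add hfin1 hfin2]
  exact (ENNReal.toReal_le_toReal (measure_ne_top _ _) (ENNReal.add_ne_top.2 ⟨hfin1, hfin2⟩)).2 h1

end TwoSteps

/-! ## §2 The full even–odd sweep `F = O ∘ₖ E` -/

section Full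

variable {Ω : Type*} [MeasurableSpace Ω] {X : Ω → ℝ} {μ : Measure Ω} {β : ℕ → ℝ} {K : ℕ}

/-- **THE FULL (DETERMINISTIC EVEN–ODD) SWEEP OF SWAP ATTEMPTS**: first the even pairs, then the odd pairs. [ours] -/
def ptFullSweep {X : Ω → ℝ} (hXm : Measurable X) (β : ℕ → ℝ) (K : ℕ) :
    Kernel (Fin (K + 1) × (Fin (K + 1) → Ω)) (Fin (K + 1) × (Fin (K + 1) → Ω)) :=
  ptParitySweep hXm β K 1 ∘ₖ ptParitySweep hXm β K 0

/-- The full sweep is Markov. [ours] -/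
instance isMarkovKernel_ptFullSweep (hXm : Measurable X) : IsMarkovKernel (ptFullSweep hXm β K) := by
  unfold ptFullSweep; infer_instance

/-- **(i) the full sweep leaves the tagged target invariant.** [ours] -/
theorem invariant_ptFullSweep [IsProbabilityMeasure μ] (hXm : Measurable X) (hXb : ∃ C, ∀ x, |X x| ≤ C) :
    Kernel.Invariant (ptFullSweep hXm β K) (ptTaggedTarget X μ β K) :=
  (invariant_ptParitySweep hXm hXb 1).comp (invariant_ptParitySweep hXm hXb 0)

/-- **The full sweep moves the tag by at most TWO levels.** [ours] -/
theorem ptFullSweep_moves_le_two (hXm : Measurable X) (z : Fin (K + 1) × (Fin (K + 1) → Ω)) :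
    ∀ᵐ y ∂(ptFullSweep hXm β K z), |(((y.1 : Fin (K + 1)) : ℕ) : ℝ) - ((z.1 : Fin (K + 1)) : ℕ)| ≤ 2 :=
  comp_level_moves_le_two (lev := fun z : Fin (K + 1) × (Fin (K + 1) → Ω) => ((z.1 : Fin (K + 1)) : ℕ))
    measurable_ptLevel (ptParitySweep_nearestNeighbour hXm 0) (ptParitySweep_nearestNeighbour hXm 1) z

/-- The exact move-probability function of the half-sweep of parity `p`. [ours] -/
def ptParityMoveFn (X : Ω → ℝ) (β : ℕ → ℝ) (K p : ℕ) (z : Fin (K + 1) × (Fin (K + 1) → Ω)) : ℝ :=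
  ∑ j ∈ Finset.univ.filter (fun j : Fin K => (j : ℕ) % 2 = p), ptTagCoef K j z.1 * ptPairRatio X β K j z.2

/-- The move-probability function is measurable. [ours] -/
theorem measurable_ptParityMoveFn (hXm : Measurable X) (p : ℕ) : Measurable (ptParityMoveFn X β K p) := by
  refine measurable_from_prod_countable_right fun τ => ?_
  unfold ptParityMoveFn
  dsimp only
  exact Finset.measurable_sum _ fun j _ => (measurable_ptPairRatio (β := β) hXm j).const_mul _

omit [MeasurableSpace Ω] in
/-- `0 ≤ m_p ≤ 1`. [ours] -/
theorem ptParityMoveFn_mem (p : ℕ) (z : Fin (K + 1) × (Fin (K + 1) → Ω)) :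
    0 ≤ ptParityMoveFn X β K p z ∧ ptParityMoveFn X β K p z ≤ 1 := by
  classical
  refine ⟨Finset.sum_nonneg fun j _ => mul_nonneg (ptTagCoef_mem j z.1).1 (ptPairRatio_mem j z.2).1, ?_⟩
  have h := ptPairCycle_moveFn_le_one (X := X) (β := β) (pairwise_apart_ptParityPairs K p) z
  rwa [toFinset_ptParityPairs] at h

/-- The half-sweep moves the tag with probability exactly `m_p`. [ours] -/
theorem ptParitySweep_real_moves_eq_moveFn (hXm : Measurable X) (p : ℕ) (z : Fin (K + 1) × (Fin (K + 1) → Ω)) :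
    (ptParitySweep hXm β K p z).real {y | ((y.1 : Fin (K + 1)) : ℕ) ≠ ((z.1 : Fin (K + 1)) : ℕ)} =
      ptParityMoveFn X β K p z :=
  ptParitySweep_real_moves_eq hXm p z

/-- **(iii) THE FULL SWEEP MOVES THE TAG WITH PROBABILITY AT MOST `m_E(z) + (E m_O)(z)`.** [ours] -/
theorem ptFullSweep_real_moves_le (hXm : Measurable X) (z : Fin (K + 1) × (Fin (K + 1) → Ω)) :
    (ptFullSweep hXm β K z).real {y | ((y.1 : Fin (K + 1)) : ℕ) ≠ ((z.1 : Fin (K + 1)) : ℕ)} ≤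
      ptParityMoveFn X β K 0 z + kop (ptParitySweep hXm β K 0) (ptParityMoveFn X β K 1) z := by
  have h := comp_real_moves_le (κ := ptParitySweep hXm β K 0) (η := ptParitySweep hXm β K 1)
    (lev := fun z : Fin (K + 1) × (Fin (K + 1) → Ω) => ((z.1 : Fin (K + 1)) : ℕ)) measurable_ptLevel z
  simp only [ptParitySweep_real_moves_eq_moveFn hXm] at h
  exact h

variable [IsProbabilityMeasure μ]

/-- **The stationary mean of the bound is `ā_K`**: `∫ (m_E + E m_O) dπ = (2/(K+1))·Σ_j swapAcc X μ β_j β_{j+1}`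
(invariance of the target under `E`; even plus odd is everything). [ours] -/
theorem ptFullSweep_rate_integral (hXm : Measurable X) (hXb : ∃ C, ∀ x, |X x| ≤ C) :
    ∫ z, ptParityMoveFn X β K 0 z + kop (ptParitySweep hXm β K 0) (ptParityMoveFn X β K 1) z
        ∂(ptTaggedTarget X μ β K) =
      2 / (K + 1) * ∑ j : Fin K, swapAcc X μ (β (j : ℕ)) (β ((j : ℕ) + 1)) := by
  haveI := isProbabilityMeasure_ptTaggedTarget (μ := μ) (β := β) (K := K) hXm hXb
  have hb : ∀ p (z : Fin (K + 1) × (Fin (K + 1) → Ω)), |ptParityMoveFn X β K p z| ≤ 1 := fun p z => by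
    rw [abs_of_nonneg (ptParityMoveFn_mem p z).1]; exact (ptParityMoveFn_mem p z).2
  have hi0 : Integrable (ptParityMoveFn X β K 0) (ptTaggedTarget X μ β K) :=
    integrable_of_bounded _ (measurable_ptParityMoveFn hXm 0) (hb 0)
  have hi1 : Integrable (kop (ptParitySweep hXm β K 0) (ptParityMoveFn X β K 1)) (ptTaggedTarget X μ β K) :=
    integrable_of_bounded _ (measurable_kop _ (measurable_ptParityMoveFn hXm 1)) (abs_kop_le _ (hb 1))
  rw [integral_add hi0 hi1, integral_kop _ (invariant_ptParitySweep hXm hXb 0) (measurable_ptParityMoveFn hXm 1) (hb 1)]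
  have e : ∀ p, ∫ z, ptParityMoveFn X β K p z ∂(ptTaggedTarget X μ β K) =
      2 / (K + 1) * ∑ j ∈ Finset.univ.filter (fun j : Fin K => (j : ℕ) % 2 = p),
        swapAcc X μ (β (j : ℕ)) (β ((j : ℕ) + 1)) := fun p => by
    rw [← ptParitySweep_moveRate_eq hXm hXb p]
    exact integral_congr_ae (ae_of_all _ fun z => (ptParitySweep_real_moves_eq_moveFn hXm p z).symm)
  rw [e 0, e 1, ← mul_add, sum_even_add_sum_odd]

/-- **THE LEVEL LAW OF THE FULL-SWEEP PTBC SAMPLER** `Mk ∘ₖ F` (`Mk` any tag-preserving Markov replica update,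
`K ≥ 1`): `ρ_τ(1) ≥ 1 − 24ā_K/(K(K+2))` per sweep. [ours] -/
theorem ptFullScan_level_lagOneAutocorr_ge (hXm : Measurable X) (hXb : ∃ C, ∀ x, |X x| ≤ C) (hK : 1 ≤ K)
    (Mk : Kernel (Fin (K + 1) × (Fin (K + 1) → Ω)) (Fin (K + 1) × (Fin (K + 1) → Ω))) [IsMarkovKernel Mk]
    (hMk : ∀ y, Mk y {y' | ((y'.1 : Fin (K + 1)) : ℕ) ≠ ((y.1 : Fin (K + 1)) : ℕ)} = 0) :
    1 - 24 * (2 / (K + 1) * ∑ j : Fin K, swapAcc X μ (β (j : ℕ)) (β ((j : ℕ) + 1))) / (K * (K + 2)) ≤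
      (autocov (Mk ∘ₖ ptFullSweep hXm β K) (ptTaggedTarget X μ β K) (fun z => (((z.1 : Fin (K + 1)) : ℕ) : ℝ)) 1 -
        ((K : ℝ) / 2) ^ 2) / (K * (K + 2) / 12) := by
  haveI := isProbabilityMeasure_ptTaggedTarget (μ := μ) (β := β) (K := K) hXm hXb
  rw [autocov_comp_levelPreserving_after (lev := fun z : Fin (K + 1) × (Fin (K + 1) → Ω) => ((z.1 : Fin (K + 1)) : ℕ))
    (f := fun z : Fin (K + 1) × (Fin (K + 1) → Ω) => (((z.1 : Fin (K + 1)) : ℕ) : ℝ))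
    (L := ptFullSweep hXm β K) hMk (measurable_from_nat.comp measurable_ptLevel)
    (abs_level_le fun z : Fin (K + 1) × (Fin (K + 1) → Ω) => Nat.le_of_lt_succ z.1.isLt) (fun y y' h => by simp only [h])]
  -- the movement bound with `ℓ = 2`
  have hfm : Measurable fun z : Fin (K + 1) × (Fin (K + 1) → Ω) => (((z.1 : Fin (K + 1)) : ℕ) : ℝ) :=
    measurable_from_nat.comp measurable_ptLevel
  have hfb := abs_level_le (lev := fun z : Fin (K + 1) × (Fin (K + 1) → Ω) => ((z.1 : Fin (K + 1)) : ℕ))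
    fun z => Nat.le_of_lt_succ z.1.isLt
  have hrm : Measurable fun z => ptParityMoveFn X β K 0 z + kop (ptParitySweep hXm β K 0) (ptParityMoveFn X β K 1) z :=
    (measurable_ptParityMoveFn hXm 0).add (measurable_kop _ (measurable_ptParityMoveFn hXm 1))
  have hb1 : ∀ z : Fin (K + 1) × (Fin (K + 1) → Ω), |ptParityMoveFn X β K 1 z| ≤ 1 := fun z => by
    rw [abs_of_nonneg (ptParityMoveFn_mem 1 z).1]; exact (ptParityMoveFn_mem 1 z).2
  have hr0 : ∀ z, 0 ≤ ptParityMoveFn X β K 0 z + kop (ptParitySweep hXm β K 0) (ptParityMoveFn X β K 1) z :=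
    fun z => add_nonneg (ptParityMoveFn_mem 0 z).1
      (integral_nonneg fun y => (ptParityMoveFn_mem 1 y).1)
  have hrR : ∀ z, ptParityMoveFn X β K 0 z + kop (ptParitySweep hXm β K 0) (ptParityMoveFn X β K 1) z ≤ 2 :=
    fun z => by
      have h1 := (ptParityMoveFn_mem (X := X) (β := β) 0 z).2
      have h2 := (abs_le.1 (abs_kop_le (ptParitySweep hXm β K 0) hb1 z)).2
      linarith
  have hrate : ∀ z, (ptFullSweep hXm β K z).real {y | (((y.1 : Fin (K + 1)) : ℕ) : ℝ) ≠ (((z.1 : Fin (K + 1)) : ℕ) : ℝ)} ≤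
      ptParityMoveFn X β K 0 z + kop (ptParitySweep hXm β K 0) (ptParityMoveFn X β K 1) z := fun z => by
    have e : {y : Fin (K + 1) × (Fin (K + 1) → Ω) | (((y.1 : Fin (K + 1)) : ℕ) : ℝ) ≠ (((z.1 : Fin (K + 1)) : ℕ) : ℝ)} =
        {y | ((y.1 : Fin (K + 1)) : ℕ) ≠ ((z.1 : Fin (K + 1)) : ℕ)} := by
      ext y; simp only [Set.mem_setOf_eq, ne_eq, Nat.cast_inj]
    rw [e]; exact ptFullSweep_real_moves_le hXm z
  have h := sq_integral_sub_autocov_le (κ := ptFullSweep hXm β K) (π := ptTaggedTarget X μ β K)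
    (invariant_ptFullSweep hXm hXb) hfm hfb (ptFullSweep_moves_le_two hXm) hrm hr0 hrR hrate
  rw [ptFullSweep_rate_integral hXm hXb] at h
  have hv := level_variance_eq (π := ptTaggedTarget X μ β K)
    (lev := fun z : Fin (K + 1) × (Fin (K + 1) → Ω) => ((z.1 : Fin (K + 1)) : ℕ)) measurable_ptLevel
    (fun z => Nat.le_of_lt_succ z.1.isLt) (fun k hk => ptTaggedTarget_real_level hXm hXb k hk)
  rw [level_mean_eq (lev := fun z : Fin (K + 1) × (Fin (K + 1) → Ω) => ((z.1 : Fin (K + 1)) : ℕ)) measurable_ptLevel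
    (fun z => Nat.le_of_lt_succ z.1.isLt) (fun k hk => ptTaggedTarget_real_level hXm hXb k hk)] at hv
  have hKr : (1 : ℝ) ≤ K := by exact_mod_cast hK
  have hKpos : (0 : ℝ) < K * (K + 2) / 12 := by positivity
  rw [le_div_iff₀ hKpos]
  have e : (1 - 24 * (2 / (K + 1) * ∑ j : Fin K, swapAcc X μ (β (j : ℕ)) (β ((j : ℕ) + 1))) / (K * (K + 2))) *
      (K * (K + 2) / 12) = K * (K + 2) / 12 - 2 * (2 / (K + 1) * ∑ j : Fin K, swapAcc X μ (β (j : ℕ)) (β ((j : ℕ) + 1))) := by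
    field_simp
    ring
  rw [e]
  norm_num at h
  linarith

/-- **REPLICA-NUMBER-FREE LEVEL LAW OF THE FULL-SWEEP PTBC SAMPLER**: on the uniform ladder from `a` to `b > a` with
a variance floor `0 < m ≤ Var_{μ_u}(X)` on `[a,b]`, `Mk ∘ₖ F` has `ρ_τ(1) ≥ 1 − 192/(e·m·(b−a)²)` per sweep for EVERY
`K ≥ 1` and every tag-preserving Markov replica update `Mk`. [ours] -/
theorem ptFullScan_level_lagOneAutocorr_ge_kfree (hXm : Measurable X) (hXb : ∃ C, ∀ x, |X x| ≤ C) {a b m : ℝ}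
    (hab : a < b) (hm0 : 0 < m) (hm : ∀ u ∈ Icc a b, m ≤ variance X (μ.tilted fun x => u * X x)) (hK : 1 ≤ K)
    (Mk : Kernel (Fin (K + 1) × (Fin (K + 1) → Ω)) (Fin (K + 1) × (Fin (K + 1) → Ω))) [IsMarkovKernel Mk]
    (hMk : ∀ y, Mk y {y' | ((y'.1 : Fin (K + 1)) : ℕ) ≠ ((y.1 : Fin (K + 1)) : ℕ)} = 0) :
    1 - 192 / (Real.exp 1 * m * (b - a) ^ 2) ≤
      (autocov (Mk ∘ₖ ptFullSweep hXm (fun k => a + k * ((b - a) / K)) K)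
          (ptTaggedTarget X μ (fun k => a + k * ((b - a) / K)) K)
          (fun z => (((z.1 : Fin (K + 1)) : ℕ) : ℝ)) 1 - ((K : ℝ) / 2) ^ 2) / (K * (K + 2) / 12) := by
  have h := ptFullScan_level_lagOneAutocorr_ge (μ := μ) (β := fun k => a + k * ((b - a) / K)) hXm hXb hK Mk hMk
  refine le_trans ?_ h
  have hKr : (1 : ℝ) ≤ K := by exact_mod_cast hK
  have hK0 : (0 : ℝ) < K := by linarith
  set S : ℝ := ∑ j : Fin K, swapAcc X μ (a + (j : ℕ) * ((b - a) / K)) (a + (((j : ℕ) + 1 : ℕ) : ℝ) * ((b - a) / K))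
    with hS_def
  have hup : 2 / (K + 1) * S ≤ 2 * K / (K + 1) * Real.exp (-(m * (b - a) ^ 2 / (4 * K ^ 2))) :=
    pt_moveRate_le_ladder (μ := μ) hXm hXb hab.le hK hm
  have hA : 0 < m * (b - a) ^ 2 / 4 := by
    have : 0 < (b - a) ^ 2 := by nlinarith
    positivity
  have hk := ladder_rate_kfree hA hKr
  have e1 : -(m * (b - a) ^ 2 / 4 / (K : ℝ) ^ 2) = -(m * (b - a) ^ 2 / (4 * K ^ 2)) := by rw [div_div]
  rw [e1] at hk
  have e2 : 12 / (Real.exp 1 * (m * (b - a) ^ 2 / 4)) = 48 / (Real.exp 1 * m * (b - a) ^ 2) := by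
    field_simp
    ring
  rw [e2] at hk
  -- `24·(2/(K+1))S/(K(K+2)) ≤ 48 K e/((K+1)K(K+2)) = 4·[12 e/((K+1)(K+2))] ≤ 4·48/(e m (b−a)²)`
  have hK12 : (0 : ℝ) < (K + 1) * (K + 2) := by positivity
  have h1 : 24 * (2 / (K + 1) * S) / (K * (K + 2)) ≤
      24 * (2 * K / (K + 1) * Real.exp (-(m * (b - a) ^ 2 / (4 * K ^ 2)))) / (K * (K + 2)) := by
    gcongr
  have e3 : 24 * (2 * K / (K + 1) * Real.exp (-(m * (b - a) ^ 2 / (4 * K ^ 2)))) / (K * (K + 2)) =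
      4 * (12 * Real.exp (-(m * (b - a) ^ 2 / (4 * K ^ 2))) / ((K + 1) * (K + 2))) := by
    field_simp
    ring
  rw [e3] at h1
  have e4 : (192 : ℝ) / (Real.exp 1 * m * (b - a) ^ 2) = 4 * (48 / (Real.exp 1 * m * (b - a) ^ 2)) := by ring
  rw [e4]
  linarith

end Full

end Summit.Ventures.LatticeQCDFlow.Scaling

end
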